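import Mathlib
import Literature.AlgebraicGeometry.HodgeTheory.GysinKernelSplit
import Literature.AlgebraicGeometry.HodgeTheory.SubschemeStrataClassVanishing
import Literature.AlgebraicGeometry.Resolution.MarkedIdeals
import Literature.AlgebraicGeometry.Resolution.SNCStrataSmooth
import Literature.AlgebraicGeometry.Motives.VarietiesGeometricallyIntegralProofs
import Literature.AlgebraicGeometry.Motives.VarietiesProperProofs
import HarnessLib

/-!
# GysinKernelSNC

Topic `Literature/AlgebraicGeometry/HodgeTheory`. Named literature fact(s) relocated by the gate from `Summits/HodgeConjecture/HodgeConjecture/Theorems/LimitExtensionMiddleDivisorSupportSufficesSNCFact.lean`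
(accept-time relocation of `[cite]`d propositions written inline in a Summits proposal; human ruling 2026-08-15).
Sources: DeligneGriffithsMorganSullivan1975, DeligneHodgeIII1974.

* `Literature.AlgebraicGeometry.HodgeTheory.Deligne1974_ker_pullback_eq_ker_pullback_snc`
-/

namespace Literature.AlgebraicGeometry.HodgeTheory

/-- **Deligne, *Hodge III*, Prop. 8.2.7 — the simple-normal-crossings case** ("Soient des
morphismes de schémas `X̃ →π X →f Y`. On suppose que `Y` est lisse, que `X` est propre, que `X̃` est
propre et lisse et que `π` est surjectif. Alors, les noyaux de `f^*` et de `(fπ)^*` dans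
`Hⁿ(Y, ℚ)` sont égaux"), for `Y` a smooth projective variety over `ℂ`, `X = ⋃ᵢ V(Dᵢ)` the union
of the members of a simple normal crossings boundary `E = (Dᵢ)` on `Y` (`Resolution.HasSNC`: at
every point a regular system of parameters in which each member through the point is a
coordinate hyperplane; so every `V(Dᵢ)` is smooth and `X̃ := ⊔ᵢ V(Dᵢ) → X` is a surjection from a
smooth proper scheme), rendered — exactly like the general named fact
`Deligne1974_ker_pullback_eq_ker_pullback_resolution`, of which this is the special case — with
complex coefficients on the tree's carriers and in Čech form: a class `x' ∈ Hᵠ(Y(ℂ); ℂ)` whose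
restriction to the complex points `{Q | pt Q ∈ V(Dᵢ)}` of every member vanishes, vanishes on some
neighbourhood (an open `V ⊇ {Q | pt Q ∈ ⋃ᵢ V(Dᵢ)}`) of the union. For varieties with normal
crossings this is the "principle of two types" (Deligne–Griffiths–Morgan–Sullivan 1975, §5–§6;
Griffiths–Schmid 1975, §4: the weight spectral sequence of `⋃ Dᵢ` degenerates), provable from the
`∂∂̄`-lemma on the strata. [cite: DeligneHodgeIII1974, Prop. 8.2.7 (p. 40)]
[cite: DeligneGriffithsMorganSullivan1975, §5 Lemma 5.11 and §6]
[file AlgebraicGeometry/HodgeTheory/GysinKernelSNC] -/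
def Deligne1974_ker_pullback_eq_ker_pullback_snc : Prop :=
  ∀ ⦃n : ℕ⦄ ⦃X : Literature.AlgebraicGeometry.Motives.SchemeOver ℂ⦄,
    Literature.AlgebraicGeometry.Motives.IsSmoothProjective n X →
    ∀ (E : List X.left.IdealSheafData), Literature.AlgebraicGeometry.Resolution.HasSNC E →
    ∀ (q : ℕ) (x' : Literature.AlgebraicGeometry.HodgeTheory.complexBetti X q),
      (∀ D ∈ E, Literature.AlgebraicTopology.SingularHomology.singularCohomology.map ℂ ℂ
        (Literature.AlgebraicTopology.SingularHomology.subsetIncl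
          {Q : Literature.AlgebraicGeometry.Motives.ComplexPoints X |
            Q.pt ∈ ((D.support : Set X.left))}) q x' = 0) →
      ∃ V : Set (Literature.AlgebraicGeometry.Motives.ComplexPoints X), IsOpen V ∧
        {Q : Literature.AlgebraicGeometry.Motives.ComplexPoints X |
            Q.pt ∈ ⋃ D ∈ E, ((D.support : Set X.left))} ⊆ V ∧
        Literature.AlgebraicTopology.SingularHomology.singularCohomology.map ℂ ℂ
          (Literature.AlgebraicTopology.SingularHomology.subsetIncl V) q x' = 0

/-! ### Discharge (theorems only; no definitions, no named facts — D-0026)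

The fact is PROVED by the "principle of two types" road, every step of which is a theorem of the
tree: GAGA turns `X` and the strata `E_I = V(⨆_{i ∈ I} Dᵢ)` of the snc boundary into compact Kähler
manifolds and holomorphic inclusions, the strata being smooth over `ℂ` of relative dimension
`n - |I|` (`Resolution.smoothOfRelativeDimension_stratum_of_hasSNC`, Kollár 2007, 3.24); on such an
embedded strata system a complex class killed by every `(E_{i} ↪ X)(ℂ)^*` dies on an open
neighbourhood of `⋃ᵢ V(Dᵢ)(ℂ)` (`exists_isOpen_map_subsetIncl_eq_zero_of_strata`, file
`SubschemeStrataClassVanishing`: Hodge decomposition of `X^an` and of the strata, the `∂∂̄`-descent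
of Deligne–Griffiths–Morgan–Sullivan 1975 §5–§6 / Griffiths–Schmid 1975 §4 in the Čech–de Rham
complex of the strata, germ Čech descent, de Rham's theorem — `Geometry/Kaehler/StrataClassVanishing`).
What is added here is only the bookkeeping: the members of the list `E` indexed by `Fin E.length`,
`strataIdeal (E.get) I = (I.image E.get).sup id`, and "dies on `{Q | pt Q ∈ V(Dᵢ)}`" ⇒ "killed by
`(E_{i} ↪ X)(ℂ)^*`" (the continuous map `E_{i}(ℂ) → X(ℂ)` factors through that subset,
`range_map_strataHom`). -/

section Discharge

open _root_.CategoryTheory _root_.AlgebraicGeometry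
open Literature.AlgebraicTopology.SingularHomology
open Literature.AlgebraicGeometry.Resolution Literature.AlgebraicGeometry.Motives

/-- **Deligne, *Hodge III*, Prop. 8.2.7 in the simple-normal-crossings case — discharge of the
named fact `Deligne1974_ker_pullback_eq_ker_pullback_snc`.** For `X` smooth projective of
dimension `n` over `ℂ`, an snc boundary `E = (Dᵢ)` on `X` and a class `x' ∈ Hᵠ(X(ℂ); ℂ)` dying on
the complex points of every member `V(Dᵢ)`, `x'` dies on an open neighbourhood of
`{Q | pt Q ∈ ⋃ᵢ V(Dᵢ)}`. Proof: `X → Spec ℂ` is smooth of relative dimension `n`, proper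
(`IsSmoothProjective.isProper_holds`), `X` is integral (`IsSmoothProjective.isIntegral_holds`) and
closed in some `ℙᴺ_ℂ` (`IsSmoothProjective.isProjectiveOver`); every stratum
`V(⨆_{i∈I} Dᵢ) = V(Σ_{D ∈ I.image E.get} D)` is smooth over `ℂ` of relative dimension
`n - |I.image E.get|` (`Resolution.smoothOfRelativeDimension_stratum_of_hasSNC`, Kollár 2007, 3.24
with Matsumura Thm. 14.2 and §30); the hypothesis on `{Q | pt Q ∈ V(Dᵢ)}` gives
`(E_{i} ↪ X)(ℂ)^* x' = 0` because `E_{i}(ℂ) → X(ℂ)` lands in that subset (`range_map_strataHom`,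
Serre GAGA §2); conclude by `exists_isOpen_map_subsetIncl_eq_zero_of_strata` (the principle of
two types, Deligne–Griffiths–Morgan–Sullivan 1975 §5–§6, on the analytified strata system) and
`⋃_{D ∈ E} V(D) = ⋃ᵢ V(E.get i)`. [cite: DeligneHodgeIII1974, Prop. 8.2.7 (p. 40)]
[cite: DeligneGriffithsMorganSullivan1975, §5 Lemma 5.11 and §6] [cite: Kollar2007, 3.24 (p. 125)]
[cite: SerreGAGA1956, §2] -/
theorem Deligne1974_ker_pullback_eq_ker_pullback_snc_holds :
    Deligne1974_ker_pullback_eq_ker_pullback_snc := by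
  intro n X hX E hE q x' hx'
  classical
  haveI := hX.smoothOfRelativeDimension
  haveI : _root_.AlgebraicGeometry.IsProper X.hom := IsSmoothProjective.isProper_holds hX
  haveI : _root_.AlgebraicGeometry.IsIntegral X.left := IsSmoothProjective.isIntegral_holds hX
  obtain ⟨N, ιX, hιX⟩ := hX.isProjectiveOver
  haveI := hιX
  -- the members of the boundary, indexed by `Fin E.length`
  let D : Fin E.length → X.left.IdealSheafData := fun i ↦ E.get i
  have hDmem : ∀ i, D i ∈ E := fun i ↦ List.get_mem E i
  -- the expected relative dimension of the stratum `E_I`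
  let d : Finset (Fin E.length) → ℕ := fun I ↦ n - (I.image D).card
  have hmem : ∀ (I : Finset (Fin E.length)), ∀ K ∈ I.image D, K ∈ E := by
    intro I K hK
    obtain ⟨i, -, rfl⟩ := Finset.mem_image.mp hK
    exact hDmem i
  have hideal : ∀ I : Finset (Fin E.length), strataIdeal D I = (I.image D).sup id := by
    intro I
    rw [Finset.sup_image, strataIdeal, Finset.sup_eq_iSup]
    rfl
  -- the strata are smooth of the expected relative dimension (Kollár 3.24)
  haveI hsm : ∀ I, SmoothOfRelativeDimension (d I) (strataScheme D I).hom := by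
    intro I
    have h : SmoothOfRelativeDimension (n - (I.image D).card)
        (((I.image D).sup id).subschemeι ≫ X.hom) :=
      smoothOfRelativeDimension_stratum_of_hasSNC X.hom hE (I.image D) (hmem I)
    change SmoothOfRelativeDimension (n - (I.image D).card) ((strataIdeal D I).subschemeι ≫ X.hom)
    rw [hideal I]
    exact h
  -- dying on `{Q | pt Q ∈ V(D i)}` ⇒ killed by `(E_{i} ↪ X)(ℂ)^*`
  have hu : ∀ i, complexBetti.map (strataHom D {i}) q x' = 0 := fun i ↦ by
    have hr : ∀ P : ComplexPoints (strataScheme D {i}),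
        (AlgPoints.map (L := ℂ) (strataHom D {i}) P).pt ∈ ((D i).support : Set X.left) := by
      intro P
      have hP : AlgPoints.map (L := ℂ) (strataHom D {i}) P ∈
          Set.range (AlgPoints.map (L := ℂ) (strataHom D {i})) := ⟨P, rfl⟩
      rw [range_map_strataHom, strataIdeal_singleton] at hP
      exact hP
    let c : C(ComplexPoints (strataScheme D {i}),
        ↥({Q : ComplexPoints X | Q.pt ∈ ((D i).support : Set X.left)})) :=
      ⟨fun P ↦ ⟨_, hr P⟩, (AlgPoints.continuous_map (L := ℂ) _).subtype_mk _⟩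
    have hfac : AlgPoints.mapContinuous (L := ℂ) (strataHom D {i}) =
        (subsetIncl {Q : ComplexPoints X | Q.pt ∈ ((D i).support : Set X.left)}).comp c := by
      ext P
      rfl
    change singularCohomology.map ℂ ℂ (AlgPoints.mapContinuous (L := ℂ) (strataHom D {i})) q x' = 0
    rw [hfac, singularCohomology.map_comp, ModuleCat.comp_apply, hx' (D i) (hDmem i), map_zero]
  -- the principle of two types on the analytified strata system
  obtain ⟨V, hV, hsub, hres⟩ :=
    exists_isOpen_map_subsetIncl_eq_zero_of_strata (n := n) ιX D d x' hu
  refine ⟨V, hV, fun Q hQ ↦ hsub ?_, hres⟩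
  simp only [Set.mem_setOf_eq, Set.mem_iUnion] at hQ ⊢
  obtain ⟨D', hD', hQ⟩ := hQ
  obtain ⟨i, rfl⟩ := List.mem_iff_get.mp hD'
  exact ⟨i, hQ⟩

end Discharge

end Literature.AlgebraicGeometry.HodgeTheory
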